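import Mathlib.Analysis.Matrix.Spectrum
import Literature.MathematicalPhysics.QuantumLattice.GrassmannIntegralWilsonProofs
import Literature.MathematicalPhysics.QuantumLattice.SectorEigenvalueContinuation
import HarnessLib

/-!
# Adaptive coarse systems for a Dirac-type matrix (route-posited object)

Topic `Literature/MathematicalPhysics/QuantumLattice`, next to `wilsonDirac` / `spinorLift`
(`GrassmannIntegral.lean`).  Definition item `defn-IsAdaptiveCoarseSystem`, requested by route
`QuantumFields/QCD/AdaptiveBlockFermions` (crux `AdaptiveCoarseSystem`, item
stmt-QuantumFields-9494).  **Interface only**: nothing here asserts that any operator admits such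
a system.

## Content (generic finite-dimensional linear algebra over `ℂ`)

For a finite index type `ι`, a matrix `D : Matrix ι ι ℂ` (the fine operator), a matrix
`Γ : Matrix ι ι ℂ` (a grading, intended `γ₅`), a block labelling `blk : ι → Fin d → ℕ` of the
indices by `d` integer block coordinates compared modulo `nb` (blocks per direction, torus
wrap-around), a block side `b : ℕ` and a finite family `gens : Finset (ι → ℂ)` of coarse
generators:

* `blockCollar blk nb B p` — the index `p` lies in the collar of the block `B : Fin d → ℕ`: every
  block coordinate of `p` differs from that of `B` by `0` or `±1` in `ZMod nb` (the `3^d` blocks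
  around `B`);
* `collarModeCount D blk nb B t` — the local mode count `n_B`: the number of eigenvalues of the
  positive semi-definite collar operator `(D|_{collar B})ᴴ (D|_{collar B})`
  (`Matrix.toBlock`, `Matrix.isHermitian_conjTranspose_mul_self`, `Matrix.IsHermitian.eigenvalues`,
  counted with multiplicity through the eigenvalue index) strictly below the threshold `t`;
* `IsAdaptiveCoarseSystem D Γ blk nb b gens c₀ c₁ Cs Cw θ Θ N₀ N₁` — the seven clauses of the
  crux, verbatim, as a `Prop`-valued structure: (a) `collar_supported` every generator is supported
  in some collar; (b) `chiral` every generator is `Γ`-definite, `Γ g = g ∨ Γ g = -g`;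
  (c) `localDim_le` at most `N₀ + N₁ · n_B` generators are supported in the collar of `B`, with
  `n_B = collarModeCount D blk nb B ((c₀/b)²)`; (d) `riesz` Riesz stability
  `θ Σ|α_g|² ≤ ‖Σ α_g g‖² ≤ Θ Σ|α_g|²`; (e) `smooth` `D`-smoothness `b²‖D w‖² ≤ C_s²‖w‖²` on
  `W = span gens`; (f) `coercive` complementary coercivity `‖f‖² ≤ C_w² b² ‖D f‖²` for `f ⊥ gens`
  (the orthogonal-complement form of the weak approximation property); (g) `infSup` inf–sup
  stability of the compression of `D` to `gens^⊥` with constant `c₁/b`.  All norms are written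
  `(star v ⬝ᵥ v).re` and orthogonality as `star g ⬝ᵥ f = 0`, exactly as in the route file.

API: `IsAdaptiveCoarseSystem.eq_zero_of_orthogonal_of_mulVec_eq_zero` ((f) ⇒ `D` has no kernel
on `gens^⊥`), `IsAdaptiveCoarseSystem.mulVec_mem_span` ((b) ⇒ `span gens` is `Γ`-invariant),
`IsAdaptiveCoarseSystem.conjTranspose_smooth` (`Dᴴ`-smoothness from (e) when `Γᴴ Γ = 1` and
`Γ D Γ = Dᴴ`, i.e. γ₅-hermiticity), `collarModeCount_mono` and `IsAdaptiveCoarseSystem.mono`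
(monotonicity in every constant), and the torus specialisation: for
`ι = TorusSite 4 L × Fin N × Fin 4`, `Γ = spinorLift gammaFive` (`= diag(1,1,-1,-1)` on the spin
index) the chirality clause is the support condition "spin index `< 2`" / "`≥ 2`"
(`spinorLift_gammaFive_mulVec_eq_self_iff`, `spinorLift_gammaFive_mulVec_eq_neg_iff`), and
`isAdaptiveCoarseSystem_torus_iff` unfolds the predicate, with `blk p i = (p.1 i).val / b` and
`nb = L / b`, into the literal text of the crux, so that the crux reads
`∃ consts, ∀ L b U m (window), ∃ gens, IsAdaptiveCoarseSystem (wilsonDirac ρ U m 1)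
(spinorLift gammaFive) (fun p i => (p.1 i).val / b) (L / b) b gens c₀ c₁ Cs Cw θ Θ N₀ N₁`
(the rewriting of the route declaration itself lives problem-side, since `Literature` does not
import `Summits`).

## Sources and status

The bundle is **posited by the route**, not in print.  Templates: the GenEO coarse space of
Spillane–Dolean–Hauret–Nataf–Pechstein–Scheichl, Numer. Math. 126 (2013), Def. 3.7 (generalized
eigenproblems in the overlaps: local spectral problems on overlapping zones) and Def. 3.9 (coarse
space = span of the partition-of-unity images of the `m_j` lowest local eigenfunctions), with the
stable-decomposition property Def. 2.7 / Thm. 2.8 and the one-layer overlapping subdomains of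
§2.2 Def. 2.3 (= collars) — here (a), (c) tie the local coarse dimension to a local spectral
count and (d)–(f) are the stability/approximation properties; the indefinite,
non-self-adjoint version with a resolution condition is Bootland–Dolean–Graham–Ma–Scheichl, IMA J.
Numer. Anal. 43 (2022); the weak approximation property / compatible relaxation dictionary of
algebraic multigrid is Falgout–Vassilevski, SIAM J. Numer. Anal. 42 (2004) (not held here; cited
by title only); block-local low-mode ("locally coherent") deflation subspaces for the lattice
Dirac operator are Lüscher, JHEP 07 (2007) 081.  [SpillaneEtAl2013, BootlandEtAl2022,
FalgoutVassilevski2004, Luscher2007]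

## Design choices

* `d` (number of block coordinates) is a free implicit parameter (the route uses `d = 4`); the
  threshold of `collarModeCount` is a free real `t` (the route uses `t = (c₀/b)²`), which makes
  the monotonicity statement clean.
* `blockCollar` is an `abbrev`, so that `Fintype`/`DecidablePred` instances on the collar subtype
  are found by unfolding, through the same instance path as the inlined text of the route.
* The elementary facts `Re ⟨v, v⟩ = Σ ‖vᵢ‖² ≥ 0`, `> 0` for `v ≠ 0` are reused from
  `SectorEigenvalueContinuation.lean` (namespace `EigenvalueContinuation`), not restated.
* No junk values beyond those of the route text: for `b = 0` clause (c) uses `c₀ / 0 = 0` and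
  (e)–(g) degenerate exactly as printed there; `nb = 0` compares block labels in `ZMod 0 = ℤ`.
-/

noncomputable section

open Matrix Complex

namespace Literature.MathematicalPhysics.QuantumLattice

section AdaptiveCoarse

variable {ι : Type*} [Fintype ι] [DecidableEq ι] {d : ℕ}

/-! ### Collars and local mode counts -/

/-- **Collar membership.** With block labels `blk : ι → Fin d → ℕ` compared in `ZMod nb`
(`nb` blocks per direction, torus wrap-around), the index `p` lies in the collar of the block
`B : Fin d → ℕ` iff each block coordinate of `p` differs from that of `B` by `0`, `1` or `-1`
modulo `nb` — the `3^d` blocks around `B` (the overlapping subdomain `Ω_j` obtained from the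
non-overlapping subdomain `Ω'_j` = block `B` by adding one layer, in the GenEO template,
Spillane et al. 2013, §2.2 Def. 2.3; the block/torus form is posited by route
AdaptiveBlockFermions). An `abbrev`, so that decidability is found by unfolding.
[cite: SpillaneEtAl2013, §2.2 Def. 2.3 (overlapping subdomain = subdomain extended by one layer; block-collar form posited by route AdaptiveBlockFermions, not in print)] -/
abbrev blockCollar (blk : ι → Fin d → ℕ) (nb : ℕ) (B : Fin d → ℕ) (p : ι) : Prop :=
  ∀ i, ((blk p i : ℕ) : ZMod nb) - ((B i : ℕ) : ZMod nb) = 0 ∨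
    ((blk p i : ℕ) : ZMod nb) - ((B i : ℕ) : ZMod nb) = 1 ∨
      ((blk p i : ℕ) : ZMod nb) - ((B i : ℕ) : ZMod nb) = -1

/-- **Local mode count** `n_B(t)`: the number of eigenvalues (with multiplicity, through the
eigenvalue index of `Matrix.IsHermitian.eigenvalues`) of the positive semi-definite collar
operator `(D|_{collar B})ᴴ (D|_{collar B})` (`D` restricted to the collar of `B` in both indices,
`Matrix.toBlock`) that lie strictly below the threshold `t` — the number of local low modes kept
in a spectral coarse space (GenEO: the `m_j` lowest eigenfunctions of the local eigenproblem,
Spillane et al. 2013, Def. 3.7 and Def. 3.9; the singular-value form for a non-Hermitian `D` is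
posited by route AdaptiveBlockFermions).
[cite: SpillaneEtAl2013, Def. 3.7 and Def. 3.9 (local eigenproblems, m_j lowest modes; collar singular-value count posited by route AdaptiveBlockFermions, not in print)] -/
def collarModeCount (D : Matrix ι ι ℂ) (blk : ι → Fin d → ℕ) (nb : ℕ) (B : Fin d → ℕ)
    (t : ℝ) : ℕ :=
  Fintype.card {i // (Matrix.isHermitian_conjTranspose_mul_self
    (D.toBlock (blockCollar blk nb B) (blockCollar blk nb B))).eigenvalues i < t}

omit [Fintype ι] [DecidableEq ι] in
/-- `blockCollar` unfolded. [folklore] -/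
theorem blockCollar_iff (blk : ι → Fin d → ℕ) (nb : ℕ) (B : Fin d → ℕ) (p : ι) :
    blockCollar blk nb B p ↔
      ∀ i, ((blk p i : ℕ) : ZMod nb) - ((B i : ℕ) : ZMod nb) = 0 ∨
        ((blk p i : ℕ) : ZMod nb) - ((B i : ℕ) : ZMod nb) = 1 ∨
          ((blk p i : ℕ) : ZMod nb) - ((B i : ℕ) : ZMod nb) = -1 :=
  Iff.rfl

/-- The local mode count is monotone in the threshold. [folklore] -/
theorem collarModeCount_mono (D : Matrix ι ι ℂ) (blk : ι → Fin d → ℕ) (nb : ℕ) (B : Fin d → ℕ)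
    {t t' : ℝ} (h : t ≤ t') : collarModeCount D blk nb B t ≤ collarModeCount D blk nb B t' :=
  Fintype.card_subtype_mono _ _ fun _ hi => lt_of_lt_of_le hi h

/-- The local mode count is at most the size of the collar. [folklore] -/
theorem collarModeCount_le_card (D : Matrix ι ι ℂ) (blk : ι → Fin d → ℕ) (nb : ℕ)
    (B : Fin d → ℕ) (t : ℝ) :
    collarModeCount D blk nb B t ≤ Fintype.card {p // blockCollar blk nb B p} :=
  Fintype.card_subtype_le _

/-! ### The predicate -/

/-- **Adaptive coarse system** (object posited by route QuantumFields/QCD/AdaptiveBlockFermions,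
crux `AdaptiveCoarseSystem`; template: GenEO coarse spaces, Spillane et al. 2013, Def. 3.7/3.9
with the stable decomposition Def. 2.7, and the weak approximation property of algebraic
multigrid).  For a fine operator `D`, a grading `Γ`, block labels `blk` compared modulo `nb`,
block side `b`, generators `gens` and constants `c₀ c₁ Cs Cw θ Θ N₀ N₁`, the seven clauses:
(a) every generator is supported in the collar of some block; (b) every generator is
`Γ`-definite (`Γ g = g` or `Γ g = -g`); (c) local dimension: the generators supported in the
collar of `B` number at most `N₀ + N₁ · n_B`, `n_B` = number of eigenvalues of
`(D|_{collar B})ᴴ (D|_{collar B})` below `(c₀/b)²`; (d) Riesz stability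
`θ Σ|α_g|² ≤ ‖Σ α_g g‖² ≤ Θ Σ|α_g|²` for every coefficient family `α`; (e) `D`-smoothness
`b² ‖D w‖² ≤ C_s² ‖w‖²` on `W = span gens`; (f) complementary coercivity `‖f‖² ≤ C_w² b² ‖D f‖²`
for every `f ⊥ gens`; (g) inf–sup of the compression: for every `u ⊥ gens` there is `v ⊥ gens`
with `‖v‖² ≤ 1` and `c₁ ‖u‖ ≤ b · Re ⟨v, D u⟩`.  Norms are `(star v ⬝ᵥ v).re`, orthogonality is
`star g ⬝ᵥ f = 0`, as in the route file.  No positivity of the constants is built in.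
[cite: SpillaneEtAl2013, Def. 3.7, Def. 3.9 and Def. 2.7 (template; the bundle (a)–(g) is posited by route AdaptiveBlockFermions, not in print)] -/
@[mk_iff]
structure IsAdaptiveCoarseSystem (D Γ : Matrix ι ι ℂ) (blk : ι → Fin d → ℕ) (nb b : ℕ)
    (gens : Finset (ι → ℂ)) (c₀ c₁ Cs Cw θ Θ : ℝ) (N₀ N₁ : ℕ) : Prop where
  /-- (a) every generator is supported in the collar of some block `B`. -/
  collar_supported : ∀ g ∈ gens, ∃ B : Fin d → ℕ, ∀ p, g p ≠ 0 → blockCollar blk nb B p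
  /-- (b) every generator is `Γ`-definite (definite chirality). -/
  chiral : ∀ g ∈ gens, Γ *ᵥ g = g ∨ Γ *ᵥ g = -g
  /-- (c) local dimension: at most `N₀ + N₁ · n_B` generators are supported in the collar of `B`,
  `n_B` the number of eigenvalues of the collar operator `(D|collar B)ᴴ (D|collar B)` below
  `(c₀/b)²`. -/
  localDim_le : ∀ B : Fin d → ℕ,
    (gens.filter (fun g => ∀ p, g p ≠ 0 → blockCollar blk nb B p)).card ≤
      N₀ + N₁ * collarModeCount D blk nb B ((c₀ / (b : ℝ)) ^ 2)
  /-- (d) Riesz stability of the generators with constants `θ`, `Θ`. -/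
  riesz : ∀ α : (ι → ℂ) → ℂ,
    θ * (∑ g ∈ gens, ‖α g‖ ^ 2) ≤ (star (∑ g ∈ gens, α g • g) ⬝ᵥ (∑ g ∈ gens, α g • g)).re ∧
      (star (∑ g ∈ gens, α g • g) ⬝ᵥ (∑ g ∈ gens, α g • g)).re ≤ Θ * ∑ g ∈ gens, ‖α g‖ ^ 2
  /-- (e) `D`-smoothness of the coarse space: `b² ‖D w‖² ≤ C_s² ‖w‖²` on `span gens`. -/
  smooth : ∀ w ∈ Submodule.span ℂ (↑gens : Set (ι → ℂ)),
    (b : ℝ) ^ 2 * (star (D *ᵥ w) ⬝ᵥ (D *ᵥ w)).re ≤ Cs ^ 2 * (star w ⬝ᵥ w).re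
  /-- (f) complementary coercivity: `‖f‖² ≤ C_w² b² ‖D f‖²` for every `f ⊥ gens`. -/
  coercive : ∀ f, (∀ g ∈ gens, star g ⬝ᵥ f = 0) →
    (star f ⬝ᵥ f).re ≤ Cw ^ 2 * (b : ℝ) ^ 2 * (star (D *ᵥ f) ⬝ᵥ (D *ᵥ f)).re
  /-- (g) inf–sup stability of the compression of `D` to `gens^⊥`, constant `c₁ / b`. -/
  infSup : ∀ u, (∀ g ∈ gens, star g ⬝ᵥ u = 0) → ∃ v, (∀ g ∈ gens, star g ⬝ᵥ v = 0) ∧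
    (star v ⬝ᵥ v).re ≤ 1 ∧ c₁ * Real.sqrt ((star u ⬝ᵥ u).re) ≤ (b : ℝ) * (star v ⬝ᵥ (D *ᵥ u)).re

/-! ### Elementary consequences -/

omit [DecidableEq ι] in
/-- `Re ⟨v, v⟩ ≤ 0` forces `v = 0` (from `EigenvalueContinuation.re_star_dotProduct_self_pos`).
[folklore] -/
theorem eq_zero_of_re_star_dotProduct_self_nonpos {v : ι → ℂ} (h : (star v ⬝ᵥ v).re ≤ 0) :
    v = 0 := by
  by_contra hv
  exact absurd h (not_le.mpr (EigenvalueContinuation.re_star_dotProduct_self_pos hv))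

/-- A matrix with `Γᴴ Γ = 1` preserves `Re ⟨v, v⟩` (indeed `⟨Γ v, Γ v⟩ = ⟨v, v⟩`). [folklore] -/
theorem star_mulVec_dotProduct_mulVec_of_conjTranspose_mul_self {Γ : Matrix ι ι ℂ}
    (hΓ : Γᴴ * Γ = 1) (v : ι → ℂ) : star (Γ *ᵥ v) ⬝ᵥ (Γ *ᵥ v) = star v ⬝ᵥ v := by
  rw [star_mulVec, dotProduct_mulVec, vecMul_vecMul, hΓ, vecMul_one]

variable {D Γ : Matrix ι ι ℂ} {blk : ι → Fin d → ℕ} {nb b : ℕ} {gens : Finset (ι → ℂ)}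
  {c₀ c₁ Cs Cw θ Θ : ℝ} {N₀ N₁ : ℕ}

namespace IsAdaptiveCoarseSystem

/-- **No low mode is left in the fine space**: by complementary coercivity (f), a vector
orthogonal to all generators and annihilated by `D` vanishes. [folklore] -/
theorem eq_zero_of_orthogonal_of_mulVec_eq_zero
    (h : IsAdaptiveCoarseSystem D Γ blk nb b gens c₀ c₁ Cs Cw θ Θ N₀ N₁) {f : ι → ℂ}
    (hf : ∀ g ∈ gens, star g ⬝ᵥ f = 0) (hD : D *ᵥ f = 0) : f = 0 := by
  have h1 := h.coercive f hf
  rw [hD, star_zero, zero_dotProduct, Complex.zero_re, mul_zero] at h1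
  exact eq_zero_of_re_star_dotProduct_self_nonpos h1

/-- **`span gens` is `Γ`-invariant**: by (b) each generator is an eigenvector of `Γ` with
eigenvalue `±1`. [folklore] -/
theorem mulVec_mem_span (h : IsAdaptiveCoarseSystem D Γ blk nb b gens c₀ c₁ Cs Cw θ Θ N₀ N₁)
    {w : ι → ℂ} (hw : w ∈ Submodule.span ℂ (↑gens : Set (ι → ℂ))) :
    Γ *ᵥ w ∈ Submodule.span ℂ (↑gens : Set (ι → ℂ)) := by
  have key : Submodule.span ℂ (↑gens : Set (ι → ℂ)) ≤
      (Submodule.span ℂ (↑gens : Set (ι → ℂ))).comap (Matrix.mulVecLin Γ) := by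
    rw [Submodule.span_le]
    intro g hg
    simp only [SetLike.mem_coe, Submodule.mem_comap, Matrix.mulVecLin_apply]
    rcases h.chiral g (Finset.mem_coe.mp hg) with h1 | h1
    · rw [h1]
      exact Submodule.subset_span hg
    · rw [h1]
      exact Submodule.neg_mem _ (Submodule.subset_span hg)
  exact key hw

/-- **`Dᴴ`-smoothness from `D`-smoothness and γ₅-hermiticity**: if `Γᴴ Γ = 1` and
`Γ D Γ = Dᴴ`, then (b) and (e) give `b² ‖Dᴴ w‖² ≤ C_s² ‖w‖²` on `span gens`
(`Dᴴ w = Γ D (Γ w)`, `Γ w ∈ span gens`, and `Γ` preserves norms). [folklore] -/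
theorem conjTranspose_smooth (h : IsAdaptiveCoarseSystem D Γ blk nb b gens c₀ c₁ Cs Cw θ Θ N₀ N₁)
    (hΓ : Γᴴ * Γ = 1) (hΓD : Γ * D * Γ = Dᴴ) {w : ι → ℂ}
    (hw : w ∈ Submodule.span ℂ (↑gens : Set (ι → ℂ))) :
    (b : ℝ) ^ 2 * (star (Dᴴ *ᵥ w) ⬝ᵥ (Dᴴ *ᵥ w)).re ≤ Cs ^ 2 * (star w ⬝ᵥ w).re := by
  have h1 : Dᴴ *ᵥ w = Γ *ᵥ (D *ᵥ (Γ *ᵥ w)) := by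
    rw [← hΓD, mulVec_mulVec, mulVec_mulVec]
  rw [h1, star_mulVec_dotProduct_mulVec_of_conjTranspose_mul_self hΓ,
    ← star_mulVec_dotProduct_mulVec_of_conjTranspose_mul_self hΓ w]
  exact h.smooth _ (h.mulVec_mem_span hw)

/-- **Monotonicity in every constant**: the predicate is preserved when `c₀` grows (from a
non-negative value: more local modes are allowed), `c₁` and `θ` shrink, `C_s²`, `C_w²`, `Θ`, `N₀`,
`N₁` grow. [folklore] -/
theorem mono (h : IsAdaptiveCoarseSystem D Γ blk nb b gens c₀ c₁ Cs Cw θ Θ N₀ N₁)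
    {c₀' c₁' Cs' Cw' θ' Θ' : ℝ} {N₀' N₁' : ℕ} (hc₀ : 0 ≤ c₀) (hc₀' : c₀ ≤ c₀') (hc₁ : c₁' ≤ c₁)
    (hCs : Cs ^ 2 ≤ Cs' ^ 2) (hCw : Cw ^ 2 ≤ Cw' ^ 2) (hθ : θ' ≤ θ) (hΘ : Θ ≤ Θ')
    (hN₀ : N₀ ≤ N₀') (hN₁ : N₁ ≤ N₁') :
    IsAdaptiveCoarseSystem D Γ blk nb b gens c₀' c₁' Cs' Cw' θ' Θ' N₀' N₁' where
  collar_supported := h.collar_supported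
  chiral := h.chiral
  localDim_le B := by
    refine (h.localDim_le B).trans (Nat.add_le_add hN₀ (Nat.mul_le_mul hN₁ ?_))
    refine collarModeCount_mono D blk nb B (pow_le_pow_left₀ (by positivity) ?_ 2)
    exact div_le_div_of_nonneg_right hc₀' (Nat.cast_nonneg b)
  riesz α := by
    obtain ⟨h1, h2⟩ := h.riesz α
    have hS : 0 ≤ ∑ g ∈ gens, ‖α g‖ ^ 2 := Finset.sum_nonneg fun g _ => by positivity
    exact ⟨(mul_le_mul_of_nonneg_right hθ hS).trans h1, h2.trans (mul_le_mul_of_nonneg_right hΘ hS)⟩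
  smooth w hw :=
    (h.smooth w hw).trans
      (mul_le_mul_of_nonneg_right hCs (EigenvalueContinuation.re_star_dotProduct_self_nonneg w))
  coercive f hf :=
    (h.coercive f hf).trans (mul_le_mul_of_nonneg_right
      (mul_le_mul_of_nonneg_right hCw (sq_nonneg _))
      (EigenvalueContinuation.re_star_dotProduct_self_nonneg _))
  infSup u hu := by
    obtain ⟨v, hv, hv1, hv2⟩ := h.infSup u hu
    exact ⟨v, hv, hv1, (mul_le_mul_of_nonneg_right hc₁ (Real.sqrt_nonneg _)).trans hv2⟩

end IsAdaptiveCoarseSystem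

end AdaptiveCoarse

/-! ### The lattice specialisation: `Γ = 1 ⊗ 1 ⊗ γ₅` on `TorusSite 4 L × Fin N × Fin 4` -/

section Torus

open Literature.Probability.LatticeModels

variable {L N : ℕ} [NeZero L]

/-- `(γ₅ g)(x, a, s) = ε_s g(x, a, s)` with `ε = (1, 1, -1, -1)`: the lifted `γ₅` is the diagonal
chirality sign on the spin index (`spinorLift_gammaFive_eq_diagonal`). [folklore] -/
theorem spinorLift_gammaFive_mulVec (g : TorusSite 4 L × Fin N × Fin 4 → ℂ)
    (p : TorusSite 4 L × Fin N × Fin 4) :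
    (spinorLift gammaFive *ᵥ g) p = (![1, 1, -1, -1] : Fin 4 → ℂ) p.2.2 * g p := by
  rw [spinorLift_gammaFive_eq_diagonal, mulVec_diagonal]

/-- **Positive chirality = upper spin components**: `γ₅ g = g` iff `g` is supported on spin
indices `0, 1` (chiral basis, `γ₅ = diag(1, 1, -1, -1)`). [folklore] -/
theorem spinorLift_gammaFive_mulVec_eq_self_iff (g : TorusSite 4 L × Fin N × Fin 4 → ℂ) :
    spinorLift gammaFive *ᵥ g = g ↔ ∀ p, g p ≠ 0 → (p.2.2 : ℕ) < 2 := by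
  rw [funext_iff]
  refine forall_congr' fun p => ?_
  rw [spinorLift_gammaFive_mulVec]
  obtain ⟨x, a, s⟩ := p
  fin_cases s <;> simp [neg_eq_self]

/-- **Negative chirality = lower spin components**: `γ₅ g = -g` iff `g` is supported on spin
indices `2, 3`. [folklore] -/
theorem spinorLift_gammaFive_mulVec_eq_neg_iff (g : TorusSite 4 L × Fin N × Fin 4 → ℂ) :
    spinorLift gammaFive *ᵥ g = -g ↔ ∀ p, g p ≠ 0 → 2 ≤ (p.2.2 : ℕ) := by
  rw [funext_iff]
  refine forall_congr' fun p => ?_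
  rw [spinorLift_gammaFive_mulVec, Pi.neg_apply]
  obtain ⟨x, a, s⟩ := p
  fin_cases s <;> simp [self_eq_neg]

/-- The chirality clause (b) for `Γ = spinorLift γ₅` is the route's support condition on the
spin index. [folklore] -/
theorem forall_spinorLift_gammaFive_chiral_iff
    (gens : Finset (TorusSite 4 L × Fin N × Fin 4 → ℂ)) :
    (∀ g ∈ gens, spinorLift gammaFive *ᵥ g = g ∨ spinorLift gammaFive *ᵥ g = -g) ↔
      ∀ g ∈ gens, (∀ p, g p ≠ 0 → (p.2.2 : ℕ) < 2) ∨ (∀ p, g p ≠ 0 → 2 ≤ (p.2.2 : ℕ)) := by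
  simp only [spinorLift_gammaFive_mulVec_eq_self_iff, spinorLift_gammaFive_mulVec_eq_neg_iff]

/-- **The crux, unbundled.**  On `TorusSite 4 L × Fin N × Fin 4` with `Γ = spinorLift γ₅`,
block labels `blk p i = (p.1 i).val / b` (integer part of coordinate / block side) and
`nb = L / b` blocks per direction, `IsAdaptiveCoarseSystem D …` is word for word the body of
the crux `AdaptiveCoarseSystem` of route QuantumFields/QCD/AdaptiveBlockFermions (there with
`N = 3`, `D = wilsonDirac (fundamentalRep (Fin 3)) U m 1`), so that the crux is
`∃ c₀ cres c₁ Cs Cw θ Θ > 0, ∃ N₀ N₁, ∀ L b, 2 ≤ b → ∀ U m, -(cres/b²) ≤ m → m ≤ 1 → ∃ gens,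
IsAdaptiveCoarseSystem (wilsonDirac ρ U m 1) (spinorLift gammaFive) (fun p i => (p.1 i).val / b)
(L / b) b gens c₀ c₁ Cs Cw θ Θ N₀ N₁`. [folklore] -/
theorem isAdaptiveCoarseSystem_torus_iff
    (D : Matrix (TorusSite 4 L × Fin N × Fin 4) (TorusSite 4 L × Fin N × Fin 4) ℂ) (b : ℕ)
    (gens : Finset (TorusSite 4 L × Fin N × Fin 4 → ℂ)) (c₀ c₁ Cs Cw θ Θ : ℝ) (N₀ N₁ : ℕ) :
    IsAdaptiveCoarseSystem D (spinorLift gammaFive) (fun p i => (p.1 i).val / b) (L / b) b gens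
        c₀ c₁ Cs Cw θ Θ N₀ N₁ ↔
      let blk : (TorusSite 4 L × Fin N × Fin 4) → Fin 4 → ℕ := fun p i => (p.1 i).val / b
      let collar : (Fin 4 → ℕ) → (TorusSite 4 L × Fin N × Fin 4) → Prop := fun B p =>
        ∀ i, ((blk p i : ℕ) : ZMod (L / b)) - ((B i : ℕ) : ZMod (L / b)) = 0 ∨
          ((blk p i : ℕ) : ZMod (L / b)) - ((B i : ℕ) : ZMod (L / b)) = 1 ∨
            ((blk p i : ℕ) : ZMod (L / b)) - ((B i : ℕ) : ZMod (L / b)) = -1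
      let n : (Fin 4 → ℕ) → ℕ := fun B => Fintype.card {i //
        (Matrix.isHermitian_conjTranspose_mul_self (D.toBlock (collar B) (collar B))).eigenvalues
          i < (c₀ / b) ^ 2}
      (∀ g ∈ gens, ∃ B : Fin 4 → ℕ, ∀ p, g p ≠ 0 → collar B p) ∧
      (∀ g ∈ gens, (∀ p, g p ≠ 0 → (p.2.2 : ℕ) < 2) ∨ (∀ p, g p ≠ 0 → 2 ≤ (p.2.2 : ℕ))) ∧
      (∀ B : Fin 4 → ℕ,
        (gens.filter (fun g => ∀ p, g p ≠ 0 → collar B p)).card ≤ N₀ + N₁ * n B) ∧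
      (∀ α : ((TorusSite 4 L × Fin N × Fin 4) → ℂ) → ℂ,
        θ * (∑ g ∈ gens, ‖α g‖ ^ 2) ≤
            (star (∑ g ∈ gens, α g • g) ⬝ᵥ (∑ g ∈ gens, α g • g)).re ∧
          (star (∑ g ∈ gens, α g • g) ⬝ᵥ (∑ g ∈ gens, α g • g)).re ≤
            Θ * ∑ g ∈ gens, ‖α g‖ ^ 2) ∧
      (∀ w ∈ Submodule.span ℂ (↑gens : Set ((TorusSite 4 L × Fin N × Fin 4) → ℂ)),
        (b : ℝ) ^ 2 * (star (D *ᵥ w) ⬝ᵥ (D *ᵥ w)).re ≤ Cs ^ 2 * (star w ⬝ᵥ w).re) ∧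
      (∀ f, (∀ g ∈ gens, star g ⬝ᵥ f = 0) →
        (star f ⬝ᵥ f).re ≤ Cw ^ 2 * (b : ℝ) ^ 2 * (star (D *ᵥ f) ⬝ᵥ (D *ᵥ f)).re) ∧
      (∀ u, (∀ g ∈ gens, star g ⬝ᵥ u = 0) → ∃ v, (∀ g ∈ gens, star g ⬝ᵥ v = 0) ∧
        (star v ⬝ᵥ v).re ≤ 1 ∧
          c₁ * Real.sqrt ((star u ⬝ᵥ u).re) ≤ (b : ℝ) * (star v ⬝ᵥ (D *ᵥ u)).re) := by
  rw [isAdaptiveCoarseSystem_iff, forall_spinorLift_gammaFive_chiral_iff]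
  rfl

end Torus

end Literature.MathematicalPhysics.QuantumLattice
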